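import Mathlib
import Literature.NumberTheory.Automorphic.HilbertModularFormQExpansion

/-!
# `Γ₁(𝔫)` has finite index in `SL₂(𝓞 F)`

Stub N4 (`stub_gamma1_finiteIndex`) of line Sketch-ideate-r1-k1 of the crux
`HilbertIntegralOverconvergentIsCongruence` (stmt-Langlands-8485): the abstract transfer theorem
("algebraic over Hilbert modular forms ⇒ modular", via the congruence subgroup property, a finite
slash orbit and orbit–stabiliser) needs the level group `Γ₁(𝔫) ≤ SL₂(𝓞 F)` to have finite index
for a non-zero ideal `𝔫` of the ring of integers `𝓞 F` of a number field `F`.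

Proof: the principal congruence subgroup `Γ(𝔫) = ker (SL₂(𝓞 F) → SL₂(𝓞 F ⧸ 𝔫))`
(`Bianchi.Gamma`) is contained in `Γ₁(𝔫)` (`Bianchi.Gamma_le_Gamma1`); its target `SL₂(𝓞 F ⧸ 𝔫)`
is finite since `𝓞 F ⧸ 𝔫` is finite for `𝔫 ≠ ⊥` (`Ideal.finiteQuotientOfFreeOfNeBot`), so `Γ(𝔫)`
has finite index (`Subgroup.finiteIndex_ker`), hence so does the larger subgroup `Γ₁(𝔫)`
(`Subgroup.finiteIndex_of_le`).
-/

set_option linter.dupNamespace false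

noncomputable section

namespace Summit.Langlands.Langlands.Theorems.HilbertIntegralOverconvergentIsCongruence

open NumberField
open Literature.NumberTheory.Automorphic
open scoped MatrixGroups

/-- The principal congruence subgroup `Γ(𝔫) = ker (SL₂(𝓞 F) → SL₂(𝓞 F ⧸ 𝔫))` has finite index in
`SL₂(𝓞 F)` for `𝔫 ≠ ⊥`: the target `SL₂(𝓞 F ⧸ 𝔫)` is finite, `𝓞 F ⧸ 𝔫` being finite. -/
theorem g1f_gamma_finiteIndex (F : Type) [Field F] [NumberField F] (𝔫 : Ideal (𝓞 F))
    (h𝔫 : 𝔫 ≠ ⊥) : (Bianchi.Gamma 𝔫 : Subgroup SL(2, 𝓞 F)).FiniteIndex := by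
  haveI : Finite (𝓞 F ⧸ 𝔫) := Ideal.finiteQuotientOfFreeOfNeBot 𝔫 h𝔫
  infer_instance

/-- **stub N4 — `stub_gamma1_finiteIndex`.** For a non-zero ideal `𝔫` of the ring of integers of a
number field `F`, the level group `Γ₁(𝔫) = {(a b; c d) ∈ SL₂(𝓞 F) : c ∈ 𝔫, d ≡ 1 mod 𝔫}` has
finite index in `SL₂(𝓞 F)` (it contains the principal congruence subgroup `Γ(𝔫)`, the kernel of
reduction to the finite group `SL₂(𝓞 F ⧸ 𝔫)`). [folklore] -/
theorem stub_gamma1_finiteIndex (F : Type) [Field F] [NumberField F] (𝔫 : Ideal (𝓞 F))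
    (h𝔫 : 𝔫 ≠ ⊥) : (Bianchi.Gamma1 𝔫 : Subgroup SL(2, 𝓞 F)).FiniteIndex :=
  haveI := g1f_gamma_finiteIndex F 𝔫 h𝔫
  Subgroup.finiteIndex_of_le (Bianchi.Gamma_le_Gamma1 𝔫)

end Summit.Langlands.Langlands.Theorems.HilbertIntegralOverconvergentIsCongruence
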